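import Literature.MathematicalPhysics.QuantumFieldTheory.Balaban1983to89.B7Eq31BCH
import Literature.MathematicalPhysics.QuantumFieldTheory.Balaban1983to89.B8Ineq132
import Literature.MathematicalPhysics.QuantumFieldTheory.Balaban1983to89.B7Eq92Concrete

/-!
# `Balaban1983to89.B8Eq182Proof` — T. Bałaban, *Spaces of regular gauge field configurations on a lattice and gauge
# fixing conditions*, Commun. Math. Phys. **99** (1985) 75–102 [Balaban1985RegularSpaces]: (1.82)–(1.85) p. 90 IN THE
# ALGEBRA — `(1/i) log(e^{−iY}e^{iY+iX}) = g(i ad_Y)X + O(|X|²)` and `(1/i) log(e^{ia}e^{−iY}e^{iY+iX}) = a + g(i ad_Y)X +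
# O(|X|²) + O(|a||X|)` from [3] (41), (31), with explicit constants (file 1 of 2 for row B8.Eq1.84; file 2 =
# `B8Eq184Proof`, the lattice displays (1.81)–(1.85))

statement-level skeleton of published theorems with citation tags; proofs where landed; nothing here is a claim about the Yang–Mills mass gap

PDF held: `paper:balaban1985-cmp99-regular-spaces-gauge-fixing` (journal page = PDF page + 74); [3] = [Balaban1985Averaging]
`paper:balaban1985-cmp98-averaging` (journal page = PDF page + 16).  READ AS IMAGES for this module (renders
`run/shared/lean/pub/pub-balaban/b2b-balaban-ref1/pages/…-x2.png`): B8 pp. 89, 90 [PDF 15, 16]; B7 p. 23 [PDF 7].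

WHAT IS REPRODUCED.  SKELETON row **B8.Eq1.84** ((1.80)–(1.85) p. 90; cell `lit-balaban`, Phase 2, seat p05 gen 2,
referee ref-4, owner r05; HOME `run/shared/lean/pub/lit-balaban/`, seat dir `lit-balaban-p05/`), the ALGEBRAIC half:
the two expansions behind (1.82)–(1.85) for elements `X, Y, a` of an arbitrary complete normed `ℂ`-algebra `𝔸` with
`‖1‖ = 1` (print: `M_N(ℂ)`, operator norm; `Y = λ(b₋)`, `X = η(Dλ)(b)`, `a = ηR(u′⁻¹(b₋))A_b`).  The analytic inputs
are [3] (41) and [3] (31), ALREADY in the tree with explicit constants and imported BY NAME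
(`B7Eq38Remainder.eq41_printed`: `(1/i) log e^{iX+iY}e^{−iY} = G40 X Y + R41 X Y`, `|R41 X Y| ≤ 34|X|²` for
`|X| < 1/3`, `|Y| ≤ 1/12`; `B7Eq31BCH.eq31_printed`: `|log e^Xe^Y − X − Y| ≤ 2|X||Y|` for `|X|, |Y| ≤ 1/10`); `log` =
the series (21) of [3] = `MatrixLog.mlog`, `R(X)Y = XYX⁻¹` = `B7Eq78Linearization.conjR`.  The lattice displays
themselves ((1.81) exact; (1.82)–(1.85) at the bond `b`) are file 2, `B8Eq184Proof`.

THE PRINTED TEXT (p. 90 [PDF 16], verbatim).  *"We have (U₁^{u′⁻¹})_b = u′⁻¹(b₋)U_{1,b}R_{0,b}u′(b₊) =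
e^{iηR(u′⁻¹(b₋))A_b}e^{−iλ(b₋)}e^{iR_{0,b}λ(b₊)} = e^{iηR(u′⁻¹(b₋))A_b}e^{−iλ(b₋)}e^{iλ(b₋)+iη(Dλ)(b)}, (1.81) and using
the formulas (32), (36)–(41) [3] we obtain (U₁^{u′⁻¹})_b = e^{iηR(u′⁻¹(b₋))A_b}e^{iηg(i ad_{λ(b₋)})(Dλ)(b)+iη²𝔉₁(λ(b₋),(Dλ)(b))},
(1.82) where the Lie algebra valued function 𝔉₁ satisfies the bound |𝔉₁(λ(b₋), (Dλ)(b))| ≦ O(1)|(Dλ)(b)|². (1.83)  We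
assume of course that α₄ is sufficiently small. Using (28) and (31) [3], we get (1/iη) log(U₁^{u′⁻¹})_b = R(u′⁻¹(b₋))A_b
+ g(i ad_{λ(b₋)})(Dλ)(b) + η𝔉₂(λ(b₋), (Dλ)(b), A_b), (1.84) where |𝔉₂(λ(b₋), (Dλ)(b), A_b)| ≦ O(1)|A_b||(Dλ)(b)|. (1.85)
Now we apply the derivative D* to the expression on the right-hand side of (1.84). ηD* is a bounded operator, hence
D*η𝔉₁ satisfies the bound (1.85). The operators R(u′⁻¹(b₋)) = e^{−i ad_{λ(b₋)}} and g(i ad_{λ(b₋)}) are given by power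
series in ad_{λ(b₋)}."*  [3] p. 23 [PDF 7]: *"Another important function we will need later is Z(u) = log e^{uX+Y}e^{−Y}.
(39) Repeating the above calculations, we get Z(u) = ug(−ad_Y)X + u²∫₀¹dt(1 − t)Z″(tu), (40) and (1/i) log e^{iX+iY}e^{−iY}
= g(−i ad_Y)X + O(|X|²). (41)"*, with `g(z) = (e^{−z} − 1)/(−z)` ((33) p. 22: `e^{−A(t)}(d/dt)e^{A(t)} = g(ad_{A(t)})A′(t)`
(32)); [3] p. 22 [PDF 6]: *"Let us define Z(u, v) = log e^{uX}e^{vY}. (28) … |Z − X − Y| ≦ 2|X||Y| for |X|, |Y| ≦ c₁, (31)"*.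

DICTIONARY print ↦ Lean.  `(1/i) log(e^{−iY}e^{iY+iX})` ↦ **`W182 X Y`**; `g(i ad_Y)X` ↦ **`gAd X Y := R(e^{−iY})·G40 X Y`**
— print's own rewriting `R(u′⁻¹(b₋)) = e^{−i ad_{λ(b₋)}}` applied to [3] (41)'s linear term `g(−i ad_Y)X` = `G40 X Y`
(`e^{−z}g(−z) = g(z)` for (33)'s `g`; `G40` is characterised through the differential of `exp` by
`B7Eq38Remainder.deriv_Z39_eq`, and its identification with the power series of [7, Thm. 2.14.3] is NOT typed, as in
`B7Eq38Remainder`); the `O(|X|²)` of (1.82) (`= η²𝔉₁`) ↦ **`F183 X Y := R(e^{−iY})·R41 X Y`**; the `O(|a||X|)` of (1.84)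
(`= η²𝔉₂`) ↦ **`F185 a X Y`** = the (31)-defect `(1/i)(log(e^{ia}e^{iW}) − ia − iW)`, `W = W182 X Y`.

WHAT THIS FILE PROVES (kernel-checked, 0 sorry, axioms standard; hypotheses = the displayed radii only).
§1 `mlog_conjR` (`log R(u)W = R(u) log W`, no hypothesis), `norm_conjR_expUnit_le(_of_le_twelfth)` (`‖R(e^Z)V‖ ≤
e^{2|Z|}|V| ≤ (6/5)|V|` for `|Z| ≤ 1/12`).  §2 THE MECHANISM `e^{−iY}e^{iY+iX} = R(e^{−iY})[e^{iX+iY}e^{−iY}]`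
(`arg182_eq_conj`), hence **`eq182_alg`**: `W182 X Y = gAd X Y + F183 X Y` with **`norm_F183_le`**: `|F183 X Y| ≤ 41|X|²`
(`|X| < 1/3`, `|Y| ≤ 1/12`) — (1.82)–(1.83) with `O(1) = 41 ≥ (6/5)·34`; `exp_I_W182` (the group form of (1.82));
`norm_W182_le`, `norm_gAd_le` (`≤ 7|X|`, Schwarz lemma / Cauchy bound on [3]'s disc `|u| < 1/(3|X|)` where
`|Z₃₉| ≤ 13/7`, via `B11SchwarzRemainder`); **`hasDerivAt_W182`**: `gAd X Y` IS the derivative at `t = 0` of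
`t ↦ (1/i) log(e^{−iY}e^{iY+itX})` (any `X`, `|Y| ≤ 1/12`) — the sense in which it is "the linear part"; `gAd_smul_real`.
§3 **`eq184_alg`**: `(1/i) log(e^{ia}·e^{−iY}e^{iY+iX}) = a + gAd X Y + F183 X Y + F185 a X Y` (`|X| < 1/3`, `|Y| ≤ 1/12`,
any `a`) with **`norm_F185_le`**: `|F185 a X Y| ≤ 14|a||X|` (`|a| ≤ 1/10`, `|X| ≤ 1/70`, `|Y| ≤ 1/12`) — (1.84)–(1.85) in
the algebra, the `F183` term being print's `η𝔉₁` (kept: see file 2's reading note and the audit cell's GAPS G-B8-11(a)).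
§4 THE PRINTED REMAINDER FUNCTIONS: **`frakF1 η l D`** `:= η⁻²·F183(ηD, l)` = `𝔉₁(λ(b₋), (Dλ)(b))` and **`frakF2 η l D Ab`**
`:= η⁻²·F185(ηR(e^{−il})Ab, ηD, l)` = `𝔉₂(λ(b₋), (Dλ)(b), A_b)` — functions of exactly the printed arguments (and `η`) —
with **`norm_frakF1_le`** = (1.83) `|𝔉₁| ≤ 41|D|²` (`η > 0`, `|l| ≤ 1/12`, `η|D| < 1/3`) and **`norm_frakF2_le`** = (1.85)
`|𝔉₂| ≤ 17|Ab||D|` (`η > 0`, `|l| ≤ 1/12`, `η|D| ≤ 1/70`, `η|Ab| ≤ 1/12`).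
Constants are ADMISSIBLE values (print: unspecified `O(1)`); they include the conjugation factor `e^{2|Y|} ≤ 6/5`, which
is `1` for unitary `e^{−iY}`.  NOT DONE HERE: the power series `g(i ad_Y)` itself ([3] (32)–(35)); (1.80); (1.86)–(1.89).
-/

noncomputable section

open NormedSpace Set Filter Topology Metric
open Complex (I I_ne_zero)

namespace Literature.MathematicalPhysics.QuantumFieldTheory.Balaban1983to89.B8Eq182Proof

open MatrixLog B7BlockAvgLog B11SchwarzRemainder B7Eq38Remainder B7Eq31BCH
open B7Prop1Explicit (expUnit val_expUnit val_inv_expUnit)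
open B7Eq78Linearization (conjR conjR_apply conjR_add conjR_sub conjR_smul conjR_smul_real conjR_one)
variable {𝔸 : Type*} [NormedRing 𝔸] [NormedAlgebra ℂ 𝔸] [NormOneClass 𝔸] [CompleteSpace 𝔸]

/-! ## §1 Conjugation bookkeeping: `R(e^{Z})` costs at most `e^{2|Z|}`, and `log` commutes with `R(u)` -/

section Conjugation

omit [NormOneClass 𝔸] [CompleteSpace 𝔸] in
/-- [folklore] `log(uWu⁻¹) = u (log W) u⁻¹` for the series (21) of [3] (`B7Prop6Flat.mlog_conj`), in the `conjR`
notation of the lineage. -/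
private theorem mlog_conjR (u : 𝔸ˣ) (W : 𝔸) : mlog (conjR u W) = conjR u (mlog W) := by
  rw [conjR_apply, conjR_apply, B7Prop6Flat.mlog_conj]

/-- [folklore] `‖e^{a}‖ ≤ e^{‖a‖}` (from the tree's `‖e^{a} − 1‖ ≤ e^{‖a‖} − 1`, `Literature.Analysis.Calculus.norm_exp_sub_one_le`). -/
private theorem norm_exp_le_rexp (a : 𝔸) : ‖exp a‖ ≤ Real.exp ‖a‖ := by
  have h := Literature.Analysis.Calculus.norm_exp_sub_one_le a
  calc ‖exp a‖ = ‖(exp a - 1) + 1‖ := by rw [sub_add_cancel]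
    _ ≤ ‖exp a - 1‖ + ‖(1 : 𝔸)‖ := norm_add_le _ _
    _ ≤ (Real.exp ‖a‖ - 1) + 1 := by rw [norm_one]; linarith
    _ = Real.exp ‖a‖ := by ring

/-- [folklore] the cost of a conjugation by `e^{Z}` in a normed algebra: `‖R(e^{Z})V‖ ≤ e^{‖Z‖}·‖V‖·e^{‖Z‖}` (for
unitary `e^{Z}`, e.g. `Z ∈ 𝔤 ⊂ u(N)`, the factor is `1`; not used). -/
private theorem norm_conjR_expUnit_le (Z V : 𝔸) : ‖conjR (expUnit Z) V‖ ≤ Real.exp ‖Z‖ * ‖V‖ * Real.exp ‖Z‖ := by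
  rw [conjR_apply, val_inv_expUnit, val_expUnit, val_expUnit]
  calc ‖exp Z * V * exp (-Z)‖ ≤ ‖exp Z‖ * ‖V‖ * ‖exp (-Z)‖ :=
        (norm_mul_le _ _).trans (mul_le_mul_of_nonneg_right (norm_mul_le _ _) (norm_nonneg _))
    _ ≤ Real.exp ‖Z‖ * ‖V‖ * Real.exp ‖Z‖ := by
        have h1 := norm_exp_le_rexp Z
        have h2 := norm_exp_le_rexp (-Z)
        rw [norm_neg] at h2
        gcongr

/-- [folklore] `e^{1/6} ≤ 6/5` (`e^{1/6} = 1.1813…`; `B7Eq38Remainder.exp_le_quartic`). -/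
private theorem exp_sixth_le : Real.exp (1 / 6) ≤ 6 / 5 := by
  have h := exp_le_quartic (x := 1 / 6) (by norm_num) (by norm_num)
  have h2 : (1 : ℝ) + 1 / 6 + (1 / 6) ^ 2 / 2 + (1 / 6) ^ 3 / 6 + 5 * (1 / 6) ^ 4 / 96 ≤ 6 / 5 := by norm_num
  exact h.trans h2

/-- [folklore] on the polydisc of this file (`‖Z‖ ≤ 1/12`): `‖R(e^{Z})V‖ ≤ (6/5)‖V‖` (`e^{2/12} ≤ 6/5`). -/
private theorem norm_conjR_expUnit_le_of_le_twelfth {Z : 𝔸} (hZ : ‖Z‖ ≤ 1 / 12) (V : 𝔸) :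
    ‖conjR (expUnit Z) V‖ ≤ 6 / 5 * ‖V‖ := by
  have h := norm_conjR_expUnit_le Z V
  have hE : Real.exp ‖Z‖ * Real.exp ‖Z‖ ≤ 6 / 5 := by
    rw [← Real.exp_add]
    exact (Real.exp_le_exp.mpr (by linarith)).trans exp_sixth_le
  have hV := norm_nonneg V
  calc ‖conjR (expUnit Z) V‖ ≤ Real.exp ‖Z‖ * ‖V‖ * Real.exp ‖Z‖ := h
    _ = (Real.exp ‖Z‖ * Real.exp ‖Z‖) * ‖V‖ := by ring
    _ ≤ 6 / 5 * ‖V‖ := mul_le_mul_of_nonneg_right hE hV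

end Conjugation

/-! ## §2 (1.82)–(1.83) in the algebra: `(1/i) log(e^{−iY}e^{iY+iX}) = g(i ad_Y)X + O(|X|²)` from [3] (41) -/

section Eq182

/-- **The exponent of (1.82)**, `(1/i) log(e^{−iY}e^{iY+iX})` (print: `= ηg(i ad_{λ(b₋)})(Dλ)(b) + η²𝔉₁` at
`Y = λ(b₋)`, `X = η(Dλ)(b)`), `log` = the series (21) of [3]. [cite: Balaban1985RegularSpaces, (1.82) p.90] -/
def W182 (X Y : 𝔸) : 𝔸 := (I⁻¹ : ℂ) • mlog (exp (-(I • Y)) * exp (I • Y + I • X))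

/-- **Print's `g(i ad_Y)X`** — the linear term of (1.82)/(1.84): `R(e^{−iY})` applied to [3] (41)'s linear term
`G40 X Y` (= `g(−i ad_Y)X`; `e^{−i ad_Y}g(−i ad_Y) = g(i ad_Y)` since `e^{−z}g(−z) = g(z)` for (33)'s
`g(z) = (e^{−z} − 1)/(−z)`); characterised as a derivative in `hasDerivAt_W182`. [cite: Balaban1985RegularSpaces, (1.82), (1.84) p.90] -/
def gAd (X Y : 𝔸) : 𝔸 := conjR (expUnit (-(I • Y))) (G40 X Y)

/-- **The `O(|X|²)` of (1.82)** (`= η²𝔉₁` at `X = η(Dλ)(b)`): `R(e^{−iY})` applied to [3] (41)'s remainder `R41 X Y`.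
[cite: Balaban1985RegularSpaces, (1.82)–(1.83) p.90] -/
def F183 (X Y : 𝔸) : 𝔸 := conjR (expUnit (-(I • Y))) (R41 X Y)

omit [NormOneClass 𝔸] in
/-- THE MECHANISM: print's product `e^{−iY}e^{iY+iX}` is the conjugate by `e^{−iY}` of [3] (39)'s `e^{iX+iY}e^{−iY}`.
[cite: Balaban1985RegularSpaces, (1.82) p.90] -/
theorem arg182_eq_conj (X Y : 𝔸) :
    exp (-(I • Y)) * exp (I • Y + I • X) = conjR (expUnit (-(I • Y))) (exp (I • X + I • Y) * exp (-(I • Y))) := by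
  rw [conjR_apply, val_inv_expUnit, val_expUnit, val_expUnit, neg_neg, add_comm (I • Y) (I • X)]
  simp only [mul_assoc, Literature.Analysis.Calculus.exp_neg_mul_exp, mul_one]

omit [NormOneClass 𝔸] in
/-- The same along the ray `X ↦ tX`: `e^{−iY}e^{iY+t·iX} = R(e^{−iY})[e^{Z₃₉(t)}]` with [3] (39)'s path. [folklore] -/
private theorem arg182_eq_conj_ray (X Y : 𝔸) (t : ℂ) :
    exp (-(I • Y)) * exp (I • Y + t • (I • X)) =
      conjR (expUnit (-(I • Y))) (exp (t • (I • X) + I • Y) * exp (-(I • Y))) := by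
  rw [conjR_apply, val_inv_expUnit, val_expUnit, val_expUnit, neg_neg, add_comm (I • Y) (t • (I • X))]
  simp only [mul_assoc, Literature.Analysis.Calculus.exp_neg_mul_exp, mul_one]

omit [NormOneClass 𝔸] in
/-- `W182` through [3] (39): `(1/i) log(e^{−iY}e^{iY+iX}) = R(e^{−iY})[(1/i)·Z₃₉(1)]`, `Z₃₉(u) = log e^{iuX+iY}e^{−iY}`,
with NO smallness hypothesis (`log R(u)W = R(u) log W` holds for the series identically). [cite: Balaban1985RegularSpaces, (1.82) p.90] -/
theorem W182_eq_conj_Z39 (X Y : 𝔸) :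
    W182 X Y = conjR (expUnit (-(I • Y))) ((I⁻¹ : ℂ) • Z39 (I • X) (I • Y) 1) := by
  rw [W182, arg182_eq_conj, mlog_conjR, ← conjR_smul, Z39, one_smul]

omit [NormOneClass 𝔸] in
/-- **(1.82) in the algebra**: for `|X| < 1/3`, `|Y| ≤ 1/12`,
`(1/i) log(e^{−iY}e^{iY+iX}) = g(i ad_Y)X + F183 X Y` — [3] (41) conjugated by `e^{−iY}`.
[cite: Balaban1985RegularSpaces, (1.82) p.90] -/
theorem eq182_alg {X Y : 𝔸} (hX : ‖X‖ < 1 / 3) (hY : ‖Y‖ ≤ 1 / 12) : W182 X Y = gAd X Y + F183 X Y := by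
  have h41 := (eq41_printed hX hY).1
  rw [W182, arg182_eq_conj, mlog_conjR, ← conjR_smul, h41, conjR_add, gAd, F183]

omit [NormOneClass 𝔸] [CompleteSpace 𝔸] in
/-- `‖−iY‖ = ‖Y‖`. [folklore] -/
private theorem norm_neg_I_smul (Y : 𝔸) : ‖(-(I • Y) : 𝔸)‖ = ‖Y‖ := by
  rw [norm_neg, norm_I_smul']

/-- **(1.83) in the algebra, with a constant**: `|F183 X Y| ≤ 41|X|²` for `|X| < 1/3`, `|Y| ≤ 1/12`
(`= (6/5)·34|X|²` rounded up: [3] (41)'s `34` times the conjugation factor `e^{2|Y|} ≤ 6/5`).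
[cite: Balaban1985RegularSpaces, (1.83) p.90] -/
theorem norm_F183_le {X Y : 𝔸} (hX : ‖X‖ < 1 / 3) (hY : ‖Y‖ ≤ 1 / 12) : ‖F183 X Y‖ ≤ 41 * ‖X‖ ^ 2 := by
  have h41 := (eq41_printed hX hY).2
  have hc := norm_conjR_expUnit_le_of_le_twelfth (Z := -(I • Y)) (by rwa [norm_neg_I_smul]) (R41 X Y)
  rw [F183]
  nlinarith [sq_nonneg ‖X‖]

omit [NormOneClass 𝔸] in
/-- Radius bookkeeping for (1.82): `|X| ≤ 1/3`, `|Y| ≤ 1/12 ⟹ ‖e^{−iY}e^{iY+iX} − 1‖ ≤ e^{1/2} − 1 ≤ 13/20 < 1`, so the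
series (21) applies and `exp ∘ log` is the identity there. [folklore] -/
private theorem norm_arg182_sub_one_le {X Y : 𝔸} (hX : ‖X‖ ≤ 1 / 3) (hY : ‖Y‖ ≤ 1 / 12) :
    ‖exp (-(I • Y)) * exp (I • Y + I • X) - 1‖ ≤ 13 / 20 := by
  have h1 := norm_exp_mul_exp_sub_one_le (-(I • Y)) (I • Y + I • X)
  have h2 : ‖(-(I • Y) : 𝔸)‖ + ‖I • Y + I • X‖ ≤ 1 / 2 := by
    have := norm_add_le (I • Y) (I • X)
    rw [norm_I_smul', norm_I_smul'] at this
    rw [norm_neg_I_smul]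
    linarith
  have h3 : Real.exp (‖(-(I • Y) : 𝔸)‖ + ‖I • Y + I • X‖) ≤ Real.exp (1 / 2) := Real.exp_le_exp.mpr h2
  linarith [exp_half_le]

omit [NormOneClass 𝔸] in
/-- **(1.82) as printed — an equality in the group**: `e^{−iY}e^{iY+iX} = exp(i·W182 X Y)` (`= e^{i g(i ad_Y)X + i F183}`
by `eq182_alg`), for `|X| ≤ 1/3`, `|Y| ≤ 1/12`. [cite: Balaban1985RegularSpaces, (1.82) p.90] -/
theorem exp_I_W182 {X Y : 𝔸} (hX : ‖X‖ ≤ 1 / 3) (hY : ‖Y‖ ≤ 1 / 12) :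
    exp (I • W182 X Y) = exp (-(I • Y)) * exp (I • Y + I • X) := by
  rw [W182, smul_smul, mul_inv_cancel₀ I_ne_zero, one_smul]
  exact exp_mlog ((norm_arg182_sub_one_le hX hY).trans_lt (by norm_num))

omit [NormOneClass 𝔸] in
/-- THE SCHWARZ-LEMMA SIZES on [3]'s disc: for `0 < |X| < 1/3`, `|Y| ≤ 1/12`, the path `Z₃₉(u) = log e^{iuX+iY}e^{−iY}`
is holomorphic and bounded by `13/7` on `|u| < 1/(3|X|)` and vanishes at `0`, hence `|Z₃₉(1)| ≤ (13/7)·3|X|` and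
`|Z₃₉′(0)| ≤ (13/7)·3|X|` (`B11SchwarzRemainder.norm_le_of_orderGe` / `norm_leadCoeff_le` at order `1`). [folklore] -/
private theorem norm_Z39_one_and_deriv_le {X Y : 𝔸} (hX : ‖X‖ < 1 / 3) (hY : ‖Y‖ ≤ 1 / 12) :
    ‖Z39 (I • X) (I • Y) 1‖ ≤ 39 / 7 * ‖X‖ ∧ ‖deriv (Z39 (I • X) (I • Y)) 0‖ ≤ 39 / 7 * ‖X‖ := by
  have hY' : ‖(I • Y : 𝔸)‖ ≤ 1 / 12 := by rwa [norm_I_smul']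
  by_cases hX0 : X = 0
  · subst hX0
    have hc : Z39 (I • (0 : 𝔸)) (I • Y) = fun _ => 0 := by
      funext u
      simp only [Z39, smul_zero, zero_add, Literature.Analysis.Calculus.exp_mul_exp_neg, mlog_one]
    rw [hc]
    simp
  · have hXpos : 0 < ‖X‖ := norm_pos_iff.mpr hX0
    set f := Z39 (I • X) (I • Y) with hf
    set ρ : ℝ := (3 * ‖X‖)⁻¹ with hρdef
    have h3 : 0 < 3 * ‖X‖ := by positivity
    have hρpos : 0 < ρ := inv_pos.mpr h3
    have hρX : ρ * ‖(I • X : 𝔸)‖ ≤ 1 / 3 := by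
      rw [norm_I_smul', hρdef]
      field_simp
      nlinarith
    have h1 : (1 : ℂ) ∈ ball (0 : ℂ) ρ := by
      rw [mem_ball_zero_iff, norm_one, hρdef, lt_inv_comm₀ one_pos h3, inv_one]
      linarith
    have hd : DifferentiableOn ℂ f (ball 0 ρ) := differentiableOn_Z39 (I • X) hY' hρX
    have hM : ∀ t ∈ ball (0 : ℂ) ρ, ‖f t‖ ≤ 13 / 7 := fun t ht =>
      norm_Z39_le (norm_mul_le_third_of_mem_ball hρX ht) hY'
    have hf0 : f 0 = 0 := Z39_zero (I • X) (I • Y)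
    have hO : OrderGe f 1 := by
      have hda : DifferentiableAt ℂ f 0 := hd.differentiableAt (ball_mem_nhds _ hρpos)
      have hcont : ContinuousAt (dslope f 0) 0 := continuousAt_dslope_same.mpr hda
      refine OrderGe.of_eq_pow_smul hcont fun s => ?_
      have h := sub_smul_dslope f 0 s
      rw [sub_zero, hf0, sub_zero] at h
      rw [pow_one, h]
    have hρinv : (1 : ℝ) / ρ = 3 * ‖X‖ := by rw [hρdef, one_div, inv_inv]
    have hρinv' : ρ⁻¹ = 3 * ‖X‖ := by rw [hρdef, inv_inv]
    refine ⟨?_, ?_⟩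
    · have h := norm_le_of_orderGe hd hM hO h1
      rw [norm_one, pow_one, hρinv] at h
      linarith
    · have h := norm_leadCoeff_le hρpos hd hM hO
      rw [leadCoeff_one, pow_one, div_eq_mul_inv, hρinv'] at h
      linarith

/-- `|W182 X Y| ≤ 7|X|` for `|X| < 1/3`, `|Y| ≤ 1/12` (`(6/5)·(39/7) = 234/35 ≤ 7`): the whole exponent of (1.82) is
first order in `X = η(Dλ)(b)`. [cite: Balaban1985RegularSpaces, (1.82) p.90] -/
theorem norm_W182_le {X Y : 𝔸} (hX : ‖X‖ < 1 / 3) (hY : ‖Y‖ ≤ 1 / 12) : ‖W182 X Y‖ ≤ 7 * ‖X‖ := by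
  have h := (norm_Z39_one_and_deriv_le hX hY).1
  have hc := norm_conjR_expUnit_le_of_le_twelfth (Z := -(I • Y)) (by rwa [norm_neg_I_smul])
    ((I⁻¹ : ℂ) • Z39 (I • X) (I • Y) 1)
  rw [norm_Iinv_smul] at hc
  rw [W182_eq_conj_Z39]
  nlinarith [norm_nonneg X]

/-- `|g(i ad_Y)X| ≤ 7|X|` for `|X| < 1/3`, `|Y| ≤ 1/12` (Cauchy bound on [3] (41)'s linear term, times `6/5`).
[cite: Balaban1985RegularSpaces, (1.82), (1.84) p.90] -/
theorem norm_gAd_le {X Y : 𝔸} (hX : ‖X‖ < 1 / 3) (hY : ‖Y‖ ≤ 1 / 12) : ‖gAd X Y‖ ≤ 7 * ‖X‖ := by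
  have h := (norm_Z39_one_and_deriv_le hX hY).2
  have hc := norm_conjR_expUnit_le_of_le_twelfth (Z := -(I • Y)) (by rwa [norm_neg_I_smul]) (G40 X Y)
  have hG : ‖G40 X Y‖ = ‖deriv (Z39 (I • X) (I • Y)) 0‖ := by rw [G40, norm_Iinv_smul]
  rw [gAd]
  nlinarith [norm_nonneg X]

omit [NormOneClass 𝔸] in
/-- **`gAd X Y` IS THE LINEAR TERM of print's exponent**: `t ↦ (1/i) log(e^{−iY}e^{iY+itX})` has derivative
`g(i ad_Y)X = gAd X Y` at `t = 0` (for `|Y| ≤ 1/12`, any `X`) — [3] (40)'s linear term transported by `R(e^{−iY})`.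
[cite: Balaban1985RegularSpaces, (1.82), (1.84) p.90] -/
theorem hasDerivAt_W182 (X : 𝔸) {Y : 𝔸} (hY : ‖Y‖ ≤ 1 / 12) :
    HasDerivAt (fun t : ℂ => (I⁻¹ : ℂ) • mlog (exp (-(I • Y)) * exp (I • Y + t • (I • X)))) (gAd X Y) 0 := by
  have hY' : ‖(I • Y : 𝔸)‖ ≤ 1 / 12 := by rwa [norm_I_smul']
  have hfun : (fun t : ℂ => (I⁻¹ : ℂ) • mlog (exp (-(I • Y)) * exp (I • Y + t • (I • X)))) =
      fun t : ℂ => (expUnit (-(I • Y)) : 𝔸) * ((I⁻¹ : ℂ) • Z39 (I • X) (I • Y) t) *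
        (((expUnit (-(I • Y)))⁻¹ : 𝔸ˣ) : 𝔸) := by
    funext t
    rw [arg182_eq_conj_ray, mlog_conjR, ← conjR_smul, conjR_apply, Z39]
  rw [hfun, gAd, conjR_apply, G40]
  exact (((hasDerivAt_Z39 (I • X) hY').const_smul (I⁻¹ : ℂ)).const_mul _).mul_const _

omit [NormOneClass 𝔸] in
/-- `g(i ad_Y)` is real-homogeneous in its argument: `gAd (c•X) Y = c•gAd X Y` (`|Y| ≤ 1/12`; [3] (41)'s linear term is
the differential of `exp`, `B7Eq38Remainder.deriv_Z39_eq`).  Used to pass from `X = η(Dλ)(b)` to `(Dλ)(b)`.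
[cite: Balaban1985RegularSpaces, (1.82), (1.84) p.90] -/
theorem gAd_smul_real (c : ℝ) (X : 𝔸) {Y : 𝔸} (hY : ‖Y‖ ≤ 1 / 12) : gAd (c • X) Y = c • gAd X Y := by
  have hY' : ‖(I • Y : 𝔸)‖ ≤ 1 / 12 := by rwa [norm_I_smul']
  have h1 : G40 (c • X) Y = c • G40 X Y := by
    rw [G40, G40, deriv_Z39_eq (I • (c • X)) hY', deriv_Z39_eq (I • X) hY']
    rw [show (I • (c • X) : 𝔸) = ((c : ℂ)) • (I • X) by
      rw [← Complex.coe_smul, smul_comm], map_smul, smul_mul_assoc, smul_comm, Complex.coe_smul]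
  rw [gAd, gAd, h1, conjR_smul_real]

end Eq182

/-! ## §3 (1.84)–(1.85) in the algebra: one more factor `e^{ia}`, by [3] (31) -/

section Eq184

/-- **The `O(|a||X|)` of (1.84)** (`= η²𝔉₂` at `a = ηR(u′⁻¹(b₋))A_b`, `X = η(Dλ)(b)`): the BCH defect
`(1/i)(log(e^{ia}e^{iW}) − ia − iW)`, `W = W182 X Y`, of [3] (28)/(31). [cite: Balaban1985RegularSpaces, (1.84)–(1.85) p.90] -/
def F185 (a X Y : 𝔸) : 𝔸 := (I⁻¹ : ℂ) • (mlog (exp (I • a) * exp (I • W182 X Y)) - I • a - I • W182 X Y)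

omit [NormOneClass 𝔸] in
/-- **(1.84) in the algebra**: for `|X| ≤ 1/3`, `|Y| ≤ 1/12` and any `a`,
`(1/i) log(e^{ia}·e^{−iY}e^{iY+iX}) = a + g(i ad_Y)X + F183 X Y + F185 a X Y`.
[cite: Balaban1985RegularSpaces, (1.84) p.90] -/
theorem eq184_alg {X Y : 𝔸} (hX : ‖X‖ < 1 / 3) (hY : ‖Y‖ ≤ 1 / 12) (a : 𝔸) :
    (I⁻¹ : ℂ) • mlog (exp (I • a) * (exp (-(I • Y)) * exp (I • Y + I • X))) =
      a + gAd X Y + F183 X Y + F185 a X Y := by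
  rw [← exp_I_W182 hX.le hY, add_assoc a, ← eq182_alg hX hY, F185]
  rw [smul_sub, smul_sub, smul_smul, smul_smul, inv_mul_cancel₀ I_ne_zero, one_smul, one_smul]
  abel

/-- **(1.85) in the algebra, with a constant**: `|F185 a X Y| ≤ 14|a||X|` for `|a| ≤ 1/10`, `|X| ≤ 1/70`, `|Y| ≤ 1/12`
([3] (31): `|log e^{ia}e^{iW} − ia − iW| ≤ 2|a||W|` on `|a|, |W| ≤ 1/10`, and `|W| ≤ 7|X| ≤ 1/10`).
[cite: Balaban1985RegularSpaces, (1.85) p.90] -/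
theorem norm_F185_le {a X Y : 𝔸} (ha : ‖a‖ ≤ 1 / 10) (hX : ‖X‖ ≤ 1 / 70) (hY : ‖Y‖ ≤ 1 / 12) :
    ‖F185 a X Y‖ ≤ 14 * ‖a‖ * ‖X‖ := by
  have hW := norm_W182_le (lt_of_le_of_lt hX (by norm_num)) hY
  have hW' : ‖(I • W182 X Y : 𝔸)‖ ≤ 1 / 10 := by rw [norm_I_smul']; linarith
  have ha' : ‖(I • a : 𝔸)‖ ≤ 1 / 10 := by rwa [norm_I_smul']
  have h31 := eq31_printed ha' hW'
  rw [norm_I_smul', norm_I_smul'] at h31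
  rw [F185, norm_Iinv_smul]
  have ha0 := norm_nonneg a
  nlinarith

end Eq184

/-! ## §4 The remainders `𝔉₁`, `𝔉₂` as functions of the printed arguments, with the bounds (1.83), (1.85) -/

section Remainders

/-- **`𝔉₁(λ(b₋), (Dλ)(b))` of (1.82)–(1.83)**, explicit: `η⁻²·F183(η(Dλ)(b), λ(b₋))`, a function of the printed
arguments `l = λ(b₋)`, `D = (Dλ)(b)` (and `η`). [cite: Balaban1985RegularSpaces, (1.82)–(1.83) p.90] -/
def frakF1 (η : ℝ) (l D : 𝔸) : 𝔸 := (η ^ 2)⁻¹ • F183 (η • D) l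

/-- **`𝔉₂(λ(b₋), (Dλ)(b), A_b)` of (1.84)–(1.85)**, explicit: `η⁻²·F185(ηR(e^{−iλ(b₋)})A_b, η(Dλ)(b), λ(b₋))`, a
function of the printed arguments `l = λ(b₋)`, `D = (Dλ)(b)`, `Ab = A_b` (and `η`).
[cite: Balaban1985RegularSpaces, (1.84)–(1.85) p.90] -/
def frakF2 (η : ℝ) (l D Ab : 𝔸) : 𝔸 := (η ^ 2)⁻¹ • F185 (η • conjR (expUnit (-(I • l))) Ab) (η • D) l

/-- **(1.83), with a constant**: `|𝔉₁(λ(b₋), (Dλ)(b))| ≤ 41|(Dλ)(b)|²` for `η > 0`, `|λ(b₋)| ≤ 1/12`,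
`η|(Dλ)(b)| < 1/3` (`l = λ(b₋)`, `D = (Dλ)(b)`). [cite: Balaban1985RegularSpaces, (1.83) p.90] -/
theorem norm_frakF1_le {η : ℝ} (hη : 0 < η) {l D : 𝔸} (hl : ‖l‖ ≤ 1 / 12) (hD : η * ‖D‖ < 1 / 3) :
    ‖frakF1 η l D‖ ≤ 41 * ‖D‖ ^ 2 := by
  have hX : ‖(η • D : 𝔸)‖ < 1 / 3 := by rwa [norm_smul, Real.norm_eq_abs, abs_of_pos hη]
  have h := norm_F183_le hX hl
  rw [norm_smul, Real.norm_eq_abs, abs_of_pos hη] at h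
  have hη2 : 0 < η ^ 2 := pow_pos hη 2
  rw [frakF1, norm_smul, norm_inv, Real.norm_eq_abs, abs_of_pos hη2, inv_mul_le_iff₀ hη2]
  nlinarith

/-- **(1.85), with a constant**: `|𝔉₂(λ(b₋), (Dλ)(b), A_b)| ≤ 17|A_b||(Dλ)(b)|` for `η > 0`, `|λ(b₋)| ≤ 1/12`,
`η|(Dλ)(b)| ≤ 1/70`, `η|A_b| ≤ 1/12` (`l = λ(b₋)`, `D = (Dλ)(b)`, `Ab = A_b`; `17 ≥ 14·(6/5)`). [cite: Balaban1985RegularSpaces, (1.85) p.90] -/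
theorem norm_frakF2_le {η : ℝ} (hη : 0 < η) {l D Ab : 𝔸} (hl : ‖l‖ ≤ 1 / 12) (hD : η * ‖D‖ ≤ 1 / 70)
    (hA : η * ‖Ab‖ ≤ 1 / 12) : ‖frakF2 η l D Ab‖ ≤ 17 * ‖Ab‖ * ‖D‖ := by
  have hX : ‖(η • D : 𝔸)‖ ≤ 1 / 70 := by rwa [norm_smul, Real.norm_eq_abs, abs_of_pos hη]
  have hc := norm_conjR_expUnit_le_of_le_twelfth (Z := -(I • l)) (by rw [norm_neg, norm_I_smul']; exact hl) Ab
  have ha : ‖(η • conjR (expUnit (-(I • l))) Ab : 𝔸)‖ ≤ 1 / 10 := by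
    rw [norm_smul, Real.norm_eq_abs, abs_of_pos hη]
    nlinarith [norm_nonneg Ab]
  have h := norm_F185_le ha hX hl
  rw [norm_smul, norm_smul, Real.norm_eq_abs, abs_of_pos hη] at h
  have hη2 : 0 < η ^ 2 := pow_pos hη 2
  rw [frakF2, norm_smul, norm_inv, Real.norm_eq_abs, abs_of_pos hη2, inv_mul_le_iff₀ hη2]
  have hAb := norm_nonneg Ab
  have hDn := norm_nonneg D
  calc ‖F185 (η • conjR (expUnit (-(I • l))) Ab) (η • D) l‖
        ≤ 14 * (η * ‖conjR (expUnit (-(I • l))) Ab‖) * (η * ‖D‖) := h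
    _ ≤ 14 * (η * (6 / 5 * ‖Ab‖)) * (η * ‖D‖) := by gcongr
    _ ≤ η ^ 2 * (17 * ‖Ab‖ * ‖D‖) := by nlinarith [mul_nonneg hAb hDn, hη2]

end Remainders

end Literature.MathematicalPhysics.QuantumFieldTheory.Balaban1983to89.B8Eq182Proof
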